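import Literature.NumberTheory.EllipticCurves.BDPAnticyclotomicPAdicLFunction
import Literature.NumberTheory.EllipticCurves.KatzPAdicLFunctionCMFieldContinuationProofs
import Literature.NumberTheory.GaloisRepresentations.HeckeLFunctionEntireContinuationShiftProofs
import Literature.NumberTheory.GaloisRepresentations.HeckeCharacterInfinityTypeNormTwistProofs
import Literature.NumberTheory.GaloisRepresentations.GlobalArtinMapNormProofs
import HarnessLib

/-!
# The special value `L(f/K, χ, 1)` read off a SHIFTED Hecke `L`-function: `L(μ, 0) = c · L(f/K, χ, 1)`
# from an identity of Euler products (Tate's continuation + the identity theorem)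

Topic `NumberTheory/EllipticCurves` (namespace `Literature.NumberTheory.EllipticCurves`). PROOFS ONLY (no
definition, no named fact, no `sorry`). Requested by route `BiquadraticEisensteinDescent` of
`Summits/BirchSwinnertonDyer` (crux `EisensteinHeartFlatCMInertBadKPrime`, line `hsieh-lambda`, layer 2 (V2)):
hypothesis (L) of the Katz–Hsieh socket `…KatzHsiehDisplay.exists_span_C_mul_eq` /
`…KatzHsiehSocket.exists_isBaseChangeLine_span_C_mul_eq` reads

  `∀ χ n, 0 < n → (χ unramified) → χ.HasInfinityType (n) (−n) →
     ∀ hL : HasEntireContinuation (heckeLFunction (λ · χ∘N_{L/K})), hL.continuation 0 = c_L · c_L′ⁿ · L(f/K, χ, 1)`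

(`rankinSelbergValueHecke f χ 1`, the value THROUGH THE CONTINUATION of the Euler product
`rankinSelbergEulerProductHecke f χ s`, `re s > 3/2`). This file proves the ANALYTIC half of that hypothesis,
reducing it to an identity of EULER PRODUCTS on the half-plane of absolute convergence:

* `continuation_zero_eq_mul_rankinSelbergValueHecke` — for a Hecke character `μ` of `L` of exponent
  `σ ≥ 1/2` (`‖μ(x)‖ = ‖x‖^σ`) which is not a norm twist: if `L(μ, s − 1) = c · L(f/K, χ, s)` as Euler products
  for `re s > 3/2`, then EVERY entire continuation `g` of `L(μ, ·)` from `re s > 1` has `g(0) = c · L(f/K, χ, 1)`.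
  Proof: `μ = μ₀ · ‖·‖^σ` with `μ₀` unitary (`exists_isUnitary_mul_of_norm_eq_rpow`), `L(μ, s) = L(μ₀, s + σ)` for
  all `s` (`heckeLFunction_mul_eq_of_forall_apply_eq_cpow`), Tate's entire continuation `g₀` of `L(μ₀, ·)`
  (`heckeLFunction_hasEntireContinuation_of_not_isNormTwist_holds`, PROVED in the tree); `g = g₀(· + σ)` on
  `re s > 1` hence everywhere (identity theorem); so `s ↦ c⁻¹ g(s − 1) = c⁻¹ g₀(s − 1 + σ)` is an entire
  continuation of `L(f/K, χ, ·)` from `re s > 3/2` (this is where `σ ≥ 1/2` enters: `re (s − 1 + σ) > 1` there),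
  and `rankinSelbergValueHecke_eq` identifies the value.
* `half_le_exponent_of_hasInfinityType`, `continuation_zero_eq_mul_rankinSelbergValueHecke_of_hasInfinityType` —
  the exponent and non-norm-twist inputs from an infinity type `(p, q)` with `p_{w₀} ≠ q_{w₀}`,
  `p_{w₀} + q_{w₀} ≤ −1` at one place of a totally complex `L` (`two_mul_exponent_eq_of_hasInfinityType`).
* `continuation_zero_eq_mul_rankinSelbergValueHecke_of_hasKatzType` — the same from a Katz type
  `kΣ + κ(1 − c)`, `k ≥ 1`, on a CM field with a `p`-adic CM type (`KatzCM.HasKatzType`; weight `−k ≤ −1`).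
* **`hLval_of_hasKatzType_of_heckeLFunction_eq`** — the socket's hypothesis (L) IN ITS LITERAL SHAPE, from the
  socket's own hypothesis (T) (`HasKatzType … (λ · χ∘N) 1 κ_n`) and the Euler-product identities
  `L(λ · χ∘N_{L/K}, s − 1) = c_L c_L′ⁿ · L(f/K, χ, s)` (`re s > 3/2`). What then remains of (L) is local
  (Euler factor by Euler factor: automorphic induction of the CM branch character along `L/K`), handled in
  `RankinSelbergEulerProductHeckeInducedProofs`.

References: [TateThesis1967] Thm. 4.4.1 (entire continuation); [WeilBNT1967] Ch. VII §3 (quasi-characters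
`ω_σ ψ`); [Nekovar1995] (0.5), §1.6–1.7 (the value through the continuation); [Castella2018] Thm. 3.1
(`L(f/K, φ, 1)`); [Hsieh2014mu] Prop. 4.9 (the Katz display on the CM side).
-/

noncomputable section

open scoped NumberField
open NumberField IsDedekindDomain Complex CongruenceSubgroup
open Literature.NumberTheory.GaloisRepresentations

namespace Literature.NumberTheory.EllipticCurves

variable {K : Type} [Field K] [NumberField K] {L : Type} [Field L] [NumberField L] {N : ℕ}

/-! ### §1 The analytic glue -/

/-- Two entire functions agreeing on the half-plane `re s > 1` are equal (identity theorem). [folklore] -/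
private theorem eq_of_differentiable_of_eqOn_one_lt_re {g g' : ℂ → ℂ} (hg : Differentiable ℂ g)
    (hg' : Differentiable ℂ g') (h : ∀ s : ℂ, 1 < s.re → g s = g' s) : g = g' := by
  refine AnalyticOnNhd.eq_of_eventuallyEq (𝕜 := ℂ) (z₀ := 2) (fun z _ ↦ hg.analyticAt z)
    (fun z _ ↦ hg'.analyticAt z) ?_
  have hopen : IsOpen {s : ℂ | 1 < s.re} := isOpen_lt continuous_const Complex.continuous_re
  filter_upwards [hopen.mem_nhds (show (1 : ℝ) < (2 : ℂ).re by norm_num)] with s hs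
  exact h s hs

/-- **`L(μ, 0) = c · L(f/K, χ, 1)` through the continuations, from the Euler-product identity
`L(μ, s − 1) = c · L(f/K, χ, s)` (`re s > 3/2`).** Here `μ` is a Hecke character of `L` of exponent `σ ≥ 1/2`
(`‖μ(x)‖ = ‖x‖^σ`) which is not a norm twist, `g = hL.continuation` is any entire continuation of the Euler
product `heckeLFunction μ` from `re s > 1`, and `rankinSelbergValueHecke f χ 1` is the value at `1` of the entire
continuation of `rankinSelbergEulerProductHecke f χ` from `re s > 3/2` (Nekovář (0.5)). Proof in the module
docstring (Tate's theorem for the unitary part `μ₀ = μ‖·‖^{−σ}`, shift, identity theorem). No hypothesis `c ≠ 0`.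
[cite: TateThesis1967, Thm. 4.4.1] [cite: Nekovar1995, (0.5) p. 611 and §1.6–1.7] -/
theorem continuation_zero_eq_mul_rankinSelbergValueHecke {μ : HeckeCharacter L} {σ : ℝ}
    (hσ : ∀ x : ideleGroup L, ‖((μ x : ℂˣ) : ℂ)‖ = ideleNorm x ^ σ) (hhalf : 1 / 2 ≤ σ)
    (hnt : ¬ μ.IsNormTwist) {f : CuspForm (Gamma0 N) 2} {χ : HeckeCharacter K} {c : ℂ}
    (hEP : ∀ s : ℂ, 3 / 2 < s.re → heckeLFunction μ (s - 1) = c * rankinSelbergEulerProductHecke f χ s)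
    (hL : LFunction.HasEntireContinuation (heckeLFunction μ)) :
    hL.continuation 0 = c * rankinSelbergValueHecke f χ 1 := by
  obtain ⟨μ₀, ν, hμ₀, hν, hdec⟩ := HeckeCharacter.exists_isUnitary_mul_of_norm_eq_rpow hσ
  have hnt₀ : ¬ μ₀.IsNormTwist := HeckeCharacter.not_isNormTwist_of_mul_normPow hν hdec hnt
  obtain ⟨g₀, hg₀, hg₀L⟩ := heckeLFunction_hasEntireContinuation_of_not_isNormTwist_holds μ₀ hμ₀ hnt₀
  -- the identity of Euler products `L(μ, s) = L(μ₀, s + σ)` (all `s`)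
  have hshift : ∀ s : ℂ, heckeLFunction μ s = heckeLFunction μ₀ (s + σ) := fun s ↦ by
    rw [hdec]; exact HeckeCharacter.heckeLFunction_mul_eq_of_forall_apply_eq_cpow μ₀ hν s
  -- `g = g₀(· + σ)` on `re s > 1`, hence everywhere
  have hg : Differentiable ℂ hL.continuation := hL.differentiable_continuation
  have hg₀' : Differentiable ℂ (fun s : ℂ ↦ g₀ (s + σ)) := hg₀.comp (differentiable_id.add_const _)
  have hagree : hL.continuation = fun s : ℂ ↦ g₀ (s + σ) := by
    refine eq_of_differentiable_of_eqOn_one_lt_re hg hg₀' fun s hs ↦ ?_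
    have hs' : 1 < (s + (σ : ℂ)).re := by
      rw [Complex.add_re, Complex.ofReal_re]; linarith
    rw [hL.continuation_eq hs, hshift s, hg₀L (s + σ) hs']
  -- the entire continuation `s ↦ c⁻¹ g(s − 1)` of `L(f/K, χ, s)` from `re s > 3/2`
  by_cases hc : c = 0
  · -- then `g₀` vanishes on an open set, so `g ≡ 0`
    have hzero : ∀ s : ℂ, 3 / 2 < s.re → g₀ (s - 1 + σ) = 0 := fun s hs ↦ by
      have hs' : 1 < (s - 1 + (σ : ℂ)).re := by
        rw [Complex.add_re, Complex.sub_re, Complex.ofReal_re, Complex.one_re]; linarith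
      rw [hg₀L _ hs', show s - 1 + (σ : ℂ) = (s - 1) + σ by ring, ← hshift, hEP s hs, hc, zero_mul]
    have hg₀zero : g₀ = fun _ ↦ 0 := by
      have h1 : (fun s : ℂ ↦ g₀ (s - 1 + σ)) = fun _ ↦ 0 := by
        refine AnalyticOnNhd.eq_of_eventuallyEq (𝕜 := ℂ) (z₀ := 2)
          (fun z _ ↦ ((hg₀.comp ((differentiable_id.sub_const _).add_const _)).analyticAt z))
          (fun z _ ↦ analyticAt_const) ?_
        have hopen : IsOpen {s : ℂ | 3 / 2 < s.re} := isOpen_lt continuous_const Complex.continuous_re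
        filter_upwards [hopen.mem_nhds (show (3 : ℝ) / 2 < (2 : ℂ).re by norm_num)] with s hs
        exact hzero s hs
      funext s
      have := congrFun h1 (s + 1 - σ)
      rwa [show s + 1 - (σ : ℂ) - 1 + σ = s by ring] at this
    rw [hagree, hg₀zero, hc, zero_mul]
  · set L₁ : ℂ → ℂ := fun s ↦ c⁻¹ * hL.continuation (s - 1) with hL₁
    have hL₁d : Differentiable ℂ L₁ := (hg.comp (differentiable_id.sub_const _)).const_mul _
    have hL₁' : ∀ s : ℂ, 3 / 2 < s.re → L₁ s = rankinSelbergEulerProductHecke f χ s := fun s hs ↦ by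
      have hs' : 1 < (s - 1 + (σ : ℂ)).re := by
        rw [Complex.add_re, Complex.sub_re, Complex.ofReal_re, Complex.one_re]; linarith
      simp only [hL₁]
      rw [hagree]
      beta_reduce
      rw [hg₀L _ hs', show s - 1 + (σ : ℂ) = (s - 1) + σ by ring, ← hshift, hEP s hs, ← mul_assoc,
        inv_mul_cancel₀ hc, one_mul]
    have hval := rankinSelbergValueHecke_eq hL₁d hL₁' 1
    rw [hval, hL₁]
    beta_reduce
    rw [sub_self, ← mul_assoc, mul_inv_cancel₀ hc, one_mul]

/-! ### §2 The inputs from an infinity type -/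

/-- **The exponent from the infinity type**: on a totally complex `L`, a character of type `(p, q)` with
`p_{w₀} + q_{w₀} ≤ −1` at one place has exponent `σ = −(p_{w₀} + q_{w₀})/2 ≥ 1/2`. [cite: Weil1956, §1] -/
theorem half_le_exponent_of_hasInfinityType [IsTotallyComplex L] {μ : HeckeCharacter L}
    {p q : InfinitePlace L → ℤ} (h : μ.HasInfinityType p q) (w₀ : InfinitePlace L) (hle : p w₀ + q w₀ ≤ -1)
    {σ : ℝ} (hσ : ∀ x : ideleGroup L, ‖((μ x : ℂˣ) : ℂ)‖ = ideleNorm x ^ σ) : 1 / 2 ≤ σ := by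
  have h2 := HeckeCharacter.two_mul_exponent_eq_of_hasInfinityType h hσ w₀
  have hsum : ((p w₀ + q w₀ : ℤ) : ℝ) ≤ -1 := by exact_mod_cast hle
  linarith

/-- **`L(μ, 0) = c · L(f/K, χ, 1)` for `μ` of infinity type `(p, q)` with `p_{w₀} ≠ q_{w₀}`, `p_{w₀} + q_{w₀} ≤ −1`**
at one infinite place of the totally complex field `L` (so `μ` is not a norm twist and has exponent `≥ 1/2`),
granted the Euler-product identity `L(μ, s − 1) = c · L(f/K, χ, s)` on `re s > 3/2`.
[cite: TateThesis1967, Thm. 4.4.1] [cite: Weil1956, §1] -/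
theorem continuation_zero_eq_mul_rankinSelbergValueHecke_of_hasInfinityType [IsTotallyComplex L]
    {μ : HeckeCharacter L} {p q : InfinitePlace L → ℤ} (h : μ.HasInfinityType p q) (w₀ : InfinitePlace L)
    (hne : p w₀ ≠ q w₀) (hle : p w₀ + q w₀ ≤ -1) {f : CuspForm (Gamma0 N) 2} {χ : HeckeCharacter K} {c : ℂ}
    (hEP : ∀ s : ℂ, 3 / 2 < s.re → heckeLFunction μ (s - 1) = c * rankinSelbergEulerProductHecke f χ s)
    (hL : LFunction.HasEntireContinuation (heckeLFunction μ)) :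
    hL.continuation 0 = c * rankinSelbergValueHecke f χ 1 := by
  obtain ⟨σ, hσ⟩ := μ.exists_norm_apply_eq_ideleNorm_rpow
  exact continuation_zero_eq_mul_rankinSelbergValueHecke hσ (half_le_exponent_of_hasInfinityType h w₀ hle hσ)
    (HeckeCharacter.not_isNormTwist_of_hasInfinityType_of_ne h w₀ hne) hEP hL

/-! ### §3 The inputs from a Katz type -/

/-- **`L(μ, 0) = c · L(f/K, χ, 1)` for `μ` of Katz type `kΣ + κ(1 − c)` with `k ≥ 1`** (`KatzCM.HasKatzType`,
Hsieh 2014 §4.1), on a totally complex `L` at a place `w₀` where exactly one of `σ_{w₀}, σ̄_{w₀}` lies in `Σ`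
(so `{p_{w₀}, q_{w₀}} = {−(k + κ_{w₀}), κ_{w₀}}`: `p ≠ q`, `p + q = −k ≤ −1`), granted the Euler-product identity
`L(μ, s − 1) = c · L(f/K, χ, s)` on `re s > 3/2`. [cite: Hsieh2014mu, §4.1] [cite: TateThesis1967, Thm. 4.4.1] -/
theorem continuation_zero_eq_mul_rankinSelbergValueHecke_of_hasKatzType [IsTotallyComplex L] {p : ℕ}
    [Fact p.Prime] {ι : PadicAlgCl p ≃+* ℂ} {Sp : Finset (HeightOneSpectrum (𝓞 L))} {μ : HeckeCharacter L}
    {k : ℕ} {κ : InfinitePlace L → ℕ} (hT : KatzCM.HasKatzType ι Sp μ k κ) (hk : 1 ≤ k) (w₀ : InfinitePlace L)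
    (hx : KatzCM.InSigma ι Sp w₀.embedding ↔ ¬ KatzCM.InSigma ι Sp (ComplexEmbedding.conjugate w₀.embedding))
    {f : CuspForm (Gamma0 N) 2} {χ : HeckeCharacter K} {c : ℂ}
    (hEP : ∀ s : ℂ, 3 / 2 < s.re → heckeLFunction μ (s - 1) = c * rankinSelbergEulerProductHecke f χ s)
    (hL : LFunction.HasEntireContinuation (heckeLFunction μ)) :
    hL.continuation 0 = c * rankinSelbergValueHecke f χ 1 := by
  classical
  have hw₀ : ¬ w₀.IsReal := InfinitePlace.not_isReal_iff_isComplex.mpr (IsTotallyComplex.isComplex w₀)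
  have hp : (HeckeCharacter.typeOfExponent (KatzCM.katzExponent ι Sp k κ)).1 w₀ =
      (if KatzCM.InSigma ι Sp w₀.embedding then -((k : ℤ) + κ w₀) else (κ w₀ : ℤ)) := by
    simp only [HeckeCharacter.typeOfExponent, KatzCM.katzExponent, InfinitePlace.mk_embedding]
  have hq : (HeckeCharacter.typeOfExponent (KatzCM.katzExponent ι Sp k κ)).2 w₀ =
      (if KatzCM.InSigma ι Sp (ComplexEmbedding.conjugate w₀.embedding) then -((k : ℤ) + κ w₀)
        else (κ w₀ : ℤ)) := by
    simp only [HeckeCharacter.typeOfExponent, KatzCM.katzExponent, if_neg hw₀,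
      InfinitePlace.mk_conjugate_eq, InfinitePlace.mk_embedding]
  have hk' : (1 : ℤ) ≤ k := by exact_mod_cast hk
  have hκ : (0 : ℤ) ≤ κ w₀ := by exact_mod_cast Nat.zero_le _
  refine continuation_zero_eq_mul_rankinSelbergValueHecke_of_hasInfinityType hT w₀ ?_ ?_ hEP hL
  · rw [hp, hq]
    by_cases hσ : KatzCM.InSigma ι Sp w₀.embedding
    · rw [if_pos hσ, if_neg (hx.mp hσ)]; omega
    · rw [if_neg hσ, if_pos (not_not.mp (mt hx.mpr hσ))]; omega
  · rw [hp, hq]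
    by_cases hσ : KatzCM.InSigma ι Sp w₀.embedding
    · rw [if_pos hσ, if_neg (hx.mp hσ)]; omega
    · rw [if_neg hσ, if_pos (not_not.mp (mt hx.mpr hσ))]; omega

/-- The same on a CM field with a `p`-adic CM type `Σ_p` (`KatzCM.IsPAdicCMType`): the orientation condition at
every place is automatic (`KatzCM.inSigma_iff_not_inSigma_conjugate`). [cite: Hsieh2014mu, §1.1 and §4.1] -/
theorem continuation_zero_eq_mul_rankinSelbergValueHecke_of_hasKatzType_of_isPAdicCMType [IsTotallyComplex L]
    [IsCMField L] {p : ℕ} [Fact p.Prime] {ι : PadicAlgCl p ≃+* ℂ} {Sp : Finset (HeightOneSpectrum (𝓞 L))}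
    (hSp : KatzCM.IsPAdicCMType p Sp) {μ : HeckeCharacter L} {k : ℕ} {κ : InfinitePlace L → ℕ}
    (hT : KatzCM.HasKatzType ι Sp μ k κ) (hk : 1 ≤ k) {f : CuspForm (Gamma0 N) 2} {χ : HeckeCharacter K}
    {c : ℂ} (hEP : ∀ s : ℂ, 3 / 2 < s.re → heckeLFunction μ (s - 1) = c * rankinSelbergEulerProductHecke f χ s)
    (hL : LFunction.HasEntireContinuation (heckeLFunction μ)) :
    hL.continuation 0 = c * rankinSelbergValueHecke f χ 1 :=
  let w₀ : InfinitePlace L := Classical.arbitrary _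
  continuation_zero_eq_mul_rankinSelbergValueHecke_of_hasKatzType hT hk w₀
    (KatzCM.inSigma_iff_not_inSigma_conjugate hSp _) hEP hL

/-! ### §4 Hypothesis (L) of the Katz–Hsieh socket, reduced to Euler products -/

/-- **Hypothesis (L) of `…KatzHsiehDisplay.exists_span_C_mul_eq` in its literal shape**, from the socket's
hypothesis (T) (Katz type `k = 1`, `κ_n` of `λ · χ∘N_{L/K}` on Hsieh's range) and the EULER-PRODUCT identities
`L(λ · χ∘N_{L/K}, s − 1) = c_L · c_L′ⁿ · L(f/K, χ, s)` for `re s > 3/2` (automorphic induction of the CM branch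
character, Euler factor by Euler factor — NOT asserted here): for every unramified `χ` of type `(n, −n)`, `n ≥ 1`,
and every entire continuation `hL` of `L(λ · χ∘N, ·)`, `hL.continuation 0 = c_L · c_L′ⁿ · rankinSelbergValueHecke f χ 1`.
`L` is a CM field carrying a `p`-adic CM type `Σ_p` (the biquadratic `K_CM·K′` of the route).
[cite: Hsieh2014mu, Prop. 4.9 (§4.8)] [cite: Castella2018, Thm. 3.1] [cite: TateThesis1967, Thm. 4.4.1] -/
theorem hLval_of_hasKatzType_of_heckeLFunction_eq [IsTotallyComplex L] [IsCMField L] [Algebra K L]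
    [IsGalois K L] {p : ℕ} [Fact p.Prime] {ι : PadicAlgCl p ≃+* ℂ} {Sp : Finset (HeightOneSpectrum (𝓞 L))}
    (hSp : KatzCM.IsPAdicCMType p Sp) {lam : HeckeCharacter L} {κ_ : ℕ → InfinitePlace L → ℕ}
    (hT : ∀ (χ : HeckeCharacter K) (n : ℕ), 0 < n → (∀ v : HeightOneSpectrum (𝓞 K), χ.IsUnramifiedAt v) →
      χ.HasInfinityType (fun _ ↦ (n : ℤ)) (fun _ ↦ -(n : ℤ)) →
      KatzCM.HasKatzType ι Sp (lam * χ.compRelNorm L) 1 (κ_ n))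
    {f : CuspForm (Gamma0 N) 2} {cL cL' : ℂ}
    (hEP : ∀ (χ : HeckeCharacter K) (n : ℕ), 0 < n → (∀ v : HeightOneSpectrum (𝓞 K), χ.IsUnramifiedAt v) →
      χ.HasInfinityType (fun _ ↦ (n : ℤ)) (fun _ ↦ -(n : ℤ)) →
      ∀ s : ℂ, 3 / 2 < s.re →
        heckeLFunction (lam * χ.compRelNorm L) (s - 1) = cL * cL' ^ n * rankinSelbergEulerProductHecke f χ s) :
    ∀ (χ : HeckeCharacter K) (n : ℕ), 0 < n → (∀ v : HeightOneSpectrum (𝓞 K), χ.IsUnramifiedAt v) →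
      χ.HasInfinityType (fun _ ↦ (n : ℤ)) (fun _ ↦ -(n : ℤ)) →
      ∀ hL : LFunction.HasEntireContinuation (heckeLFunction (lam * χ.compRelNorm L)),
        hL.continuation 0 = cL * cL' ^ n * rankinSelbergValueHecke f χ 1 :=
  fun χ n hn hu hi hL ↦
    continuation_zero_eq_mul_rankinSelbergValueHecke_of_hasKatzType_of_isPAdicCMType hSp (hT χ n hn hu hi) le_rfl
      (hEP χ n hn hu hi) hL

end Literature.NumberTheory.EllipticCurves

end
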